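import Mathlib
import Summits.Ventures.PercRepro2.TypedTwoEdgesAtO
import Summits.Ventures.PercRepro2.TypedContract
import Summits.Ventures.PercRepro2.TypedVanishing

/-!
# A root edge at a mark `o` of typed degree two: one deletion vanishes (blind cell PercRepro2,
night-3 g17, 2026-08-27; NIGHT3-CERT.md §26)

For the kernel `K₃` of (HCOV): if `o` carries exactly two typed edges `e = {o, u}` (any `u`) and
`f = {o, a₁}`, both of type `1`, every other edge at `o` being pinned closed and untyped, then the
deletion–contraction identity at `o` (`typedCount_two_edges_at_o`) has ONE deletion term only:

  `N_τ = D₂ + 2 · N_τ(F ∖ f, f pinned closed)`   (`typedCount_o_root_edge`),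

because with `e` deleted `o` is pendant at the root `a₁` and the count vanishes
(`typedCount_o_pendant_root`: the pendant rule `typedCount_pendant_o'` makes it the count with
`f` pinned open, the contraction `typedCount_contract_open` identifies `o` with `a₁`, and the
typed root coincidence `typedCount_eq_zero_of_o_eq_a1` kills it).  Hence at such an `o` row 2′TRI
is EXACTLY the lower bound `D₂ ≥ −2 · N_τ(F ∖ f)` on the double-attachment class
(`typedCount_nonneg_o_root_iff`) — the class itself is negative on NEG-191's witness
(`witness_superadditivity_defect`: `D₂ = −2` against `N_τ(F ∖ f) = 18`), so this is the one
degree-2 attachment of `o` where the class sign and the row differ.  With the pendant rule at `e`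
the remaining count is the instance with `o` contracted into `u`
(`typedCount_o_root_edge_contract`).  Own work; standard axioms.
-/

namespace Summit.Ventures.PercRepro2

namespace CovForm

namespace TypedRed

open OneTyped Contract TypedVanish

section Main

open Classical

variable {V : Type*} {E : Type*} [Fintype E] [DecidableEq E] {R : Type*} [Field R]
  [LinearOrder R] [IsStrictOrderedRing R]

variable (ends : E → Sym2 V) (o a₁ a₂ a₃ b : V)

/-- **`o` pendant at the root `a₁`**: a typed edge `f = {o, a₁}` of type `≥ 1` whose end `o` carries
no other typed or open edge contributes nothing — the count is the count with `f` pinned open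
(`typedCount_pendant_o'`), i.e. with `o` contracted into `a₁` (`typedCount_contract_open`), which
is the typed root coincidence `o = a₁` (`typedCount_eq_zero_of_o_eq_a1`). -/
theorem typedCount_o_pendant_root {f : E} (hf : ends f = s(o, a₁)) (ho1 : o ≠ a₁) (ho2 : o ≠ a₂)
    (ho3 : o ≠ a₃) (hob : o ≠ b) (F : Finset E) (hfF : f ∈ F) (z : Config E) (τ : E → ℕ)
    (hτ : 1 ≤ τ f) (hcl : ∀ e', e' ≠ f → o ∈ ends e' → e' ∉ F ∧ z e' = false) :
    typedCount F z τ (K3 ends o a₁ a₂ a₃ b : Config E → Config E → Config E → R) = 0 := by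
  rw [typedCount_pendant_o' ends o a₁ a₂ a₃ b hf ho1 ho1 ho2 ho3 hob F hfF z τ hτ hcl,
    typedCount_type_three F f hfF z _ (by simp)]
  have hf' : ends f = s(a₁, o) := by rw [hf, Sym2.eq_swap]
  rw [typedCount_contract_open ends o a₁ a₂ a₃ b hf' (F.erase f) (Finset.notMem_erase f F)
    (Function.update z f true) (by simp) _]
  rw [contractMap_of_mem (by simp : o ∈ ({a₁, o} : Finset V)),
    contractMap_of_mem (by simp : a₁ ∈ ({a₁, o} : Finset V)), typedCount_eq_zero_of_o_eq_a1,
    mul_zero]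

/-- The mirror: `o` pendant at the root `a₂`. -/
theorem typedCount_o_pendant_root' {f : E} (hf : ends f = s(o, a₂)) (ho1 : o ≠ a₁) (ho2 : o ≠ a₂)
    (ho3 : o ≠ a₃) (hob : o ≠ b) (F : Finset E) (hfF : f ∈ F) (z : Config E) (τ : E → ℕ)
    (hτ : 1 ≤ τ f) (hcl : ∀ e', e' ≠ f → o ∈ ends e' → e' ∉ F ∧ z e' = false) :
    typedCount F z τ (K3 ends o a₁ a₂ a₃ b : Config E → Config E → Config E → R) = 0 := by
  rw [typedCount_pendant_o' ends o a₁ a₂ a₃ b hf ho2 ho1 ho2 ho3 hob F hfF z τ hτ hcl,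
    typedCount_type_three F f hfF z _ (by simp)]
  have hf' : ends f = s(a₂, o) := by rw [hf, Sym2.eq_swap]
  rw [typedCount_contract_open ends o a₁ a₂ a₃ b hf' (F.erase f) (Finset.notMem_erase f F)
    (Function.update z f true) (by simp) _]
  rw [contractMap_of_mem (by simp : o ∈ ({a₂, o} : Finset V)),
    contractMap_of_mem (by simp : a₂ ∈ ({a₂, o} : Finset V)), typedCount_eq_zero_of_o_eq_a2,
    mul_zero]

/-- **A root edge at a mark `o` of typed degree two**: with `e = {o, u}` (any `u`) and
`f = {o, a₁}` in `F`, both of type `1`, every other edge at `o` pinned closed and untyped,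
`N_τ = D₂ + 2 · N_τ(F ∖ f)` — the deletion of `e` (`o` pendant at the root) vanishes. -/
theorem typedCount_o_root_edge {e f : E} {u : V} (he : ends e = s(o, u)) (hf : ends f = s(o, a₁))
    (hou : o ≠ u) (hef : e ≠ f) (ho1 : o ≠ a₁) (ho2 : o ≠ a₂) (ho3 : o ≠ a₃) (hob : o ≠ b)
    (F : Finset E) (heF : e ∈ F) (hfF : f ∈ F) (z : Config E) (τ : E → ℕ) (hτe : τ e = 1)
    (hτf : τ f = 1) (hcl : ∀ e', e' ≠ e → e' ≠ f → o ∈ ends e' → e' ∉ F ∧ z e' = false) :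
    typedCount F z τ (K3 ends o a₁ a₂ a₃ b : Config E → Config E → Config E → R) =
      doubleClass F z τ e f (K3 ends o a₁ a₂ a₃ b) +
        2 * typedCount (F.erase f) (Function.update z f false) τ (K3 ends o a₁ a₂ a₃ b) := by
  rw [typedCount_two_edges_at_o ends o a₁ a₂ a₃ b he hf hou ho1 hef ho1 ho2 ho3 hob F heF hfF z τ
    hτe hτf hcl]
  have hE : typedCount (F.erase e) (Function.update z e false) τ
      (K3 ends o a₁ a₂ a₃ b : Config E → Config E → Config E → R) = 0 := by
    refine typedCount_o_pendant_root ends o a₁ a₂ a₃ b hf ho1 ho2 ho3 hob (F.erase e)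
      (Finset.mem_erase.2 ⟨hef.symm, hfF⟩) _ τ (by omega) ?_
    intro e' hf' ho
    by_cases he' : e' = e
    · subst he'
      exact ⟨Finset.notMem_erase e' F, Function.update_self _ _ _⟩
    · obtain ⟨h1, h2⟩ := hcl e' he' hf' ho
      exact ⟨fun h => h1 (Finset.mem_of_mem_erase h), by rw [Function.update_of_ne he']; exact h2⟩
  rw [hE]
  ring

/-- **Row 2′TRI at a root edge of a degree-two `o` is the lower bound on the double class**:
`0 ≤ N_τ ↔ −2 · N_τ(F ∖ f) ≤ D₂`. -/
theorem typedCount_nonneg_o_root_iff {e f : E} {u : V} (he : ends e = s(o, u))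
    (hf : ends f = s(o, a₁)) (hou : o ≠ u) (hef : e ≠ f) (ho1 : o ≠ a₁) (ho2 : o ≠ a₂)
    (ho3 : o ≠ a₃) (hob : o ≠ b) (F : Finset E) (heF : e ∈ F) (hfF : f ∈ F) (z : Config E)
    (τ : E → ℕ) (hτe : τ e = 1) (hτf : τ f = 1)
    (hcl : ∀ e', e' ≠ e → e' ≠ f → o ∈ ends e' → e' ∉ F ∧ z e' = false) :
    0 ≤ typedCount F z τ (K3 ends o a₁ a₂ a₃ b : Config E → Config E → Config E → R) ↔
      -(2 * typedCount (F.erase f) (Function.update z f false) τ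
          (K3 ends o a₁ a₂ a₃ b : Config E → Config E → Config E → R)) ≤
        doubleClass F z τ e f (K3 ends o a₁ a₂ a₃ b) := by
  rw [typedCount_o_root_edge ends o a₁ a₂ a₃ b he hf hou hef ho1 ho2 ho3 hob F heF hfF z τ hτe hτf
    hcl]
  constructor <;> intro h <;> linarith

/-- **The same with `o` contracted into `u`**: `N_τ(F ∖ f)` is, by the pendant rule at `e`, the
count of the instance `o := u` (the marks mapped by the contraction of `{u, o}` onto `u`):
`N_τ = D₂ + 2 · N_τ(G₀, o := u)`. -/
theorem typedCount_o_root_edge_contract {e f : E} {u : V} (he : ends e = s(o, u))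
    (hf : ends f = s(o, a₁)) (hou : o ≠ u) (hef : e ≠ f) (ho1 : o ≠ a₁) (ho2 : o ≠ a₂)
    (ho3 : o ≠ a₃) (hob : o ≠ b) (F : Finset E) (heF : e ∈ F) (hfF : f ∈ F) (z : Config E)
    (τ : E → ℕ) (hτe : τ e = 1) (hτf : τ f = 1)
    (hcl : ∀ e', e' ≠ e → e' ≠ f → o ∈ ends e' → e' ∉ F ∧ z e' = false) :
    typedCount F z τ (K3 ends o a₁ a₂ a₃ b : Config E → Config E → Config E → R) =
      doubleClass F z τ e f (K3 ends o a₁ a₂ a₃ b) +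
        2 * typedCount ((F.erase f).erase e)
          (Function.update (Function.update z f false) e true) (Function.update τ e 3)
          (K3 (contractEnds ends {u, o} u) u (contractMap {u, o} u a₁) (contractMap {u, o} u a₂)
            (contractMap {u, o} u a₃) (contractMap {u, o} u b)) := by
  rw [typedCount_o_root_edge ends o a₁ a₂ a₃ b he hf hou hef ho1 ho2 ho3 hob F heF hfF z τ hτe hτf
    hcl]
  congr 1
  have hef' : e ∈ F.erase f := Finset.mem_erase.2 ⟨hef, heF⟩
  have hcl' : ∀ e', e' ≠ e → o ∈ ends e' → e' ∉ F.erase f ∧ Function.update z f false e' = false := by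
    intro e' he' ho
    by_cases hf' : e' = f
    · subst hf'
      exact ⟨Finset.notMem_erase e' F, Function.update_self _ _ _⟩
    · obtain ⟨h1, h2⟩ := hcl e' he' hf' ho
      exact ⟨fun h => h1 (Finset.mem_of_mem_erase h), by rw [Function.update_of_ne hf']; exact h2⟩
  rw [typedCount_pendant_o' ends o a₁ a₂ a₃ b he hou ho1 ho2 ho3 hob (F.erase f) hef' _ τ
    (by omega) hcl', hτe]
  simp only [Nat.sub_self, Nat.choose_zero_right, Nat.cast_one, one_mul]
  rw [typedCount_type_three (F.erase f) e hef' _ _ (by simp)]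
  have he' : ends e = s(u, o) := by rw [he, Sym2.eq_swap]
  rw [typedCount_contract_open ends o a₁ a₂ a₃ b he' ((F.erase f).erase e)
    (Finset.notMem_erase e (F.erase f)) _ (by simp) _,
    contractMap_of_mem (by simp : o ∈ ({u, o} : Finset V))]

end Main

end TypedRed

end CovForm

end Summit.Ventures.PercRepro2
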